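import Literature.AlgebraicGeometry.Motives.QuasiProjectiveOfGeneratingSections
import Literature.AlgebraicGeometry.Motives.ProjectiveDescentNormProofs
import Literature.AlgebraicGeometry.HodgeTheory.SmoothProjectiveCompactification
import Literature.AlgebraicGeometry.HodgeTheory.GlobalInvariantCyclesProofs
import Mathlib.AlgebraicGeometry.Morphisms.Immersion
import HarnessLib

/-!
# A scheme finite — or just affine and of finite type — over a quasi-projective `k`-scheme is quasi-projective
# (EGA II, Cor. 6.1.11 with Prop. 5.3.4 (ii)); discharge of `EGAII_isQuasiProjectiveOver_of_isFinite`

Topic `AlgebraicGeometry/HodgeTheory`; namespace `Literature.AlgebraicGeometry.HodgeTheory`. THEOREMS ONLY (no definition,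
no named fact, no instance, no `sorry`).

Let `k` be a field, `Y` a quasi-projective `k`-scheme (`IsQuasiProjectiveOver`: an open `k`-immersion `j : Y ↪ P` into a
projective `ι : P ↪ ℙⁿ_k`) and `h : X → Y` an AFFINE `k`-morphism with `X` locally of finite type over `k` (e.g. `h` finite).
Then `X` is quasi-projective over `k`. This contains EGA II, Cor. 6.1.11 («tout morphisme fini est projectif») combined with
Prop. 5.3.4 (ii) (composition of quasi-projective morphisms) and Cor. 5.3.3, in the generality Görtz–Wedhorn I,
Prop. 13.76 / Thm. 13.84 give it (`r^*𝓛` is ample for `r` quasi-affine — in particular affine — and `𝓛` ample).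

Proof (Görtz–Wedhorn I, Prop. 13.47 and §13.16, in the tree's chart currency `GeneratingSections` — no invertible sheaves):
for `y ∈ Y`, graded prime avoidance (★ `GradedPrimeAvoidance.exists_form_basicOpen`, applied on the open
`Ω = (ι ∘ j).coborderRange ⊆ ℙⁿ` in which `(ι ∘ j)(Y)` is closed) gives a form `F_y` of positive degree with
`y ∈ Y_{F_y} := (ι j)⁻¹ D₊(F_y)` and `D₊(F_y) ⊆ Ω`, so that `Y_{F_y}` is AFFINE (the affine `D₊(F_y)` pulled back along
the closed immersion `Y ↪ Ω`; cf. ★ `Resolution.exists_isAffineOpen_finset_subset_of_isImmersion`); finitely many `F_y`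
cover the quasi-compact `Y`, and after raising them to a common degree `d` (`D₊(F^e) = D₊(F)`) they are forms
`G₁, …, G_N ∈ 𝒜_d` with `Y = ⋃ Y_{Gᵢ}`, `Y_{Gᵢ}` affine. Pulling back along the AFFINE `h`, the sections `(ι j h)^* Gᵢ` of
`(ι j h)^* 𝒪(d)` have the affine non-vanishing loci `h⁻¹(Y_{Gᵢ})` covering `X` — generating-sections data on `X` with
finitely many affine charts (★ `GeneratingSections.ofForms`, `Motives/ProjectiveDescentNormProofs`) —, so `X` is
quasi-projective by ★ `GeneratingSections.isQuasiProjectiveOver_of_isAffineOpen`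
(`Motives/QuasiProjectiveOfGeneratingSections`: the associated morphism `X → ℙᴹ_k` is a quasi-compact immersion).

* `exists_form_mem_isAffineOpen_preimage` — for an immersion `r : Y → Proj 𝒜` and `y ∈ Y`: a form `F` of positive degree
  with `y ∈ r⁻¹ D₊(F)` and `r⁻¹ D₊(F)` affine;
* `exists_forms_isAffineOpen_iSup_eq_top` — for `r : Y → Proj 𝒜` an immersion with `Y` quasi-compact: finitely many forms
  `G : Fin N → 𝒜_d` of one positive degree `d` with `r⁻¹ D₊(Gᵢ)` affine and `⋃ᵢ r⁻¹ D₊(Gᵢ) = Y`;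
* **`isQuasiProjectiveOver_of_isAffineHom`** — `h : X → Y` affine, `X` locally of finite type over `k`, `Y` quasi-projective
  ⇒ `X` quasi-projective; **`isQuasiProjectiveOver_of_isFinite`** (`h` finite);
* **`EGAII_isQuasiProjectiveOver_of_isFinite_holds : EGAII_isQuasiProjectiveOver_of_isFinite`** — DISCHARGE of the named fact of
  `HodgeTheory/SmoothProjectiveCompactification` (the input `hFinQP` of `….FiniteMonodromyInputs`, D-0026 debt −1).

Cell `hodgecm-mathlib`, count-neutral capital (HC_CM is proved only modulo the 7 printed citations until rung 0 closes;
this file discharges none of them): it removes the integrality hypothesis of ★ `isQuasiProjectiveOver_of_isFinite_of_surjective`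
used by the (cov-3) bricks.

## References
* A. Grothendieck, J. Dieudonné, *EGA II* (1961): Cor. 6.1.11, Prop. 5.3.4 (ii), Cor. 5.3.3, Prop. 5.1.12 / 4.6.13 (ii). [EGAII]
* U. Görtz, T. Wedhorn, *Algebraic Geometry I: Schemes*, 2nd ed. (2020): Prop. 13.47 (pp. 392–393), Prop. 13.49 (p. 393), Summary
  13.71 (1) (p. 404), Prop. 13.76 (p. 405), Thm. 13.84 (p. 408). [GortzWedhorn2020]
* Q. Liu, *Algebraic Geometry and Arithmetic Curves* (2002): Prop. 3.3.36 (b) (p. 109). [Liu2002]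
* R. Hartshorne, *Algebraic Geometry* (1977): II §4 Definition p. 103, II Thm. 7.6. [Hartshorne1977]
-/

universe u

open CategoryTheory AlgebraicGeometry Limits HomogeneousLocalization TopologicalSpace Opposite
open Literature.AlgebraicGeometry.Motives

noncomputable section

namespace Literature.AlgebraicGeometry.HodgeTheory

/-! ### Affine non-vanishing loci of forms on a scheme immersed in `Proj 𝒜` -/

section Forms

variable {A : Type u} {σ : Type*} [CommRing A] [SetLike σ A] [AddSubgroupClass σ A]
  (𝒜 : ℕ → σ) [GradedRing 𝒜] {Y : Scheme.{u}} (r : Y ⟶ Proj 𝒜) [IsImmersion r]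

/-- **Every point of a scheme immersed in `Proj 𝒜` has an AFFINE neighbourhood of the form `r⁻¹ D₊(F)`**, `F` a form of
positive degree: graded prime avoidance (★ `GradedPrimeAvoidance.exists_form_basicOpen` on `Proj 𝒜`) gives `F` with
`r y ∈ D₊(F) ⊆ Ω := r.coborderRange`, the open of `Proj 𝒜` in which `r(Y)` is closed; `D₊(F)` is affine, hence so is its
preimage under the closed immersion `Y ↪ Ω` (Görtz–Wedhorn I, Prop. 13.49 / proof of Prop. 13.47 (i) ⇒ (ii); Liu, Prop.
3.3.36 (b)). [cite: GortzWedhorn2020, Prop. 13.49 (p. 393)] [cite: Liu2002, Prop. 3.3.36 (b) (p. 109)] -/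
theorem exists_form_mem_isAffineOpen_preimage (y : Y) :
    ∃ (m : ℕ) (F : A), 0 < m ∧ F ∈ 𝒜 m ∧ y ∈ r ⁻¹ᵁ Proj.basicOpen 𝒜 F ∧
      IsAffineOpen (r ⁻¹ᵁ Proj.basicOpen 𝒜 F) := by
  classical
  have hΩ : ∀ t ∈ ({r y} : Finset ↥(Proj 𝒜)), t ∈ r.coborderRange := by
    intro t ht
    rw [Finset.mem_singleton] at ht
    subst ht
    exact subset_coborder ⟨y, rfl⟩
  obtain ⟨m, F, hm, hF, hT, hle⟩ := GradedPrimeAvoidance.exists_form_basicOpen 𝒜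
    (𝟙 (Proj 𝒜)) Function.injective_id IsClosedMap.id {r y} r.coborderRange hΩ
  have hle' : Proj.basicOpen 𝒜 F ≤ r.coborderRange := by simpa using hle
  refine ⟨m, F, hm, hF, ?_, ?_⟩
  · have hy := hT (r y) (Finset.mem_singleton_self _)
    simpa using hy
  · have hD : IsAffineOpen (Proj.basicOpen 𝒜 F) := Proj.isAffineOpen_basicOpen 𝒜 F hF hm
    have hV : IsAffineOpen (r.coborderRange.ι ⁻¹ᵁ Proj.basicOpen 𝒜 F) := by
      rw [← r.coborderRange.ι.isAffineOpen_iff_of_isOpenImmersion,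
        Scheme.Hom.image_preimage_eq_opensRange_inf, Scheme.Opens.opensRange_ι,
        inf_eq_right.mpr hle']
      exact hD
    have hpre : r.liftCoborder ⁻¹ᵁ (r.coborderRange.ι ⁻¹ᵁ Proj.basicOpen 𝒜 F) =
        r ⁻¹ᵁ Proj.basicOpen 𝒜 F := by
      rw [← Scheme.Hom.comp_preimage, Scheme.Hom.liftCoborder_ι]
    rw [← hpre]
    exact hV.preimage r.liftCoborder

/-- **Finitely many forms of ONE positive degree with affine non-vanishing loci covering `Y`** (`Y` quasi-compact,
immersed in `Proj 𝒜`): finitely many of the affine `r⁻¹ D₊(F_y)` cover `Y`; raise the `F_y` to the common degree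
`d = ∏ deg F_y` (`D₊(F^e) = D₊(F)`). In terms of line bundles: `r^*𝒪(d)` is generated by finitely many sections with
affine non-vanishing loci (Görtz–Wedhorn I, Prop. 13.47 (i) ⇒ (iv) for the ample `r^*𝒪(1)`).
[cite: GortzWedhorn2020, Prop. 13.47 (pp. 392–393)] -/
theorem exists_forms_isAffineOpen_iSup_eq_top [CompactSpace Y] :
    ∃ (N d : ℕ) (G : Fin N → A), 0 < d ∧ (∀ i, G i ∈ 𝒜 d) ∧ (∀ i, IsAffineOpen (r ⁻¹ᵁ Proj.basicOpen 𝒜 (G i))) ∧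
      ⨆ i, r ⁻¹ᵁ Proj.basicOpen 𝒜 (G i) = ⊤ := by
  classical
  choose m F hm hF hy haff using exists_form_mem_isAffineOpen_preimage 𝒜 r
  -- a finite subcover of the affine neighbourhoods `r⁻¹ D₊(F_y)`
  obtain ⟨T, hT⟩ := isCompact_univ.elim_finite_subcover (fun y : Y ↦ (r ⁻¹ᵁ Proj.basicOpen 𝒜 (F y) : Set Y))
    (fun y ↦ (r ⁻¹ᵁ Proj.basicOpen 𝒜 (F y)).2) (fun y _ ↦ Set.mem_iUnion.mpr ⟨y, hy y⟩)
  -- common degree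
  set d : ℕ := ∏ y ∈ T, m y with hd
  have hd0 : 0 < d := Finset.prod_pos fun y _ ↦ hm y
  have hdvd : ∀ y ∈ T, m y ∣ d := fun y hyT ↦ Finset.dvd_prod_of_mem m hyT
  set e := T.equivFin with he
  refine ⟨T.card, d, fun i ↦ F (e.symm i) ^ (d / m (e.symm i)), hd0, fun i ↦ ?_, fun i ↦ ?_, ?_⟩
  · have h := SetLike.pow_mem_graded (d / m (e.symm i).1) (hF (e.symm i))
    rwa [smul_eq_mul, Nat.div_mul_cancel (hdvd _ (e.symm i).2)] at h
  · rw [Proj.basicOpen_pow 𝒜 _ _ (Nat.div_pos (Nat.le_of_dvd hd0 (hdvd _ (e.symm i).2)) (hm _))]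
    exact haff _
  · rw [← top_le_iff]
    intro y _
    have hyU : y ∈ ⋃ z ∈ T, (r ⁻¹ᵁ Proj.basicOpen 𝒜 (F z) : Set Y) := hT (Set.mem_univ y)
    obtain ⟨z, hzT, hyz⟩ := Set.mem_iUnion₂.mp hyU
    refine Opens.mem_iSup.mpr ⟨e ⟨z, hzT⟩, ?_⟩
    rw [Proj.basicOpen_pow 𝒜 _ _ (Nat.div_pos (Nat.le_of_dvd hd0 (hdvd _ (e.symm _).2)) (hm _))]
    simpa [Equiv.symm_apply_apply] using hyz

end Forms

/-! ### Affine and finite-type over quasi-projective is quasi-projective -/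

section Main

variable {k : Type u} [Field k] {X Y : SchemeOver k} (h : X ⟶ Y)

/-- **A `k`-scheme locally of finite type which is AFFINE over a quasi-projective `k`-scheme is quasi-projective**
(Görtz–Wedhorn I, Thm. 13.84 / Prop. 13.76 with Summary 13.71 (1): `h^*𝓛` is ample for `h` affine and `𝓛` ample; EGA II
Prop. 5.1.12 with 5.3.4 (ii)). Proof in chart form: with `r = ι ∘ j : Y ↪ ℙⁿ_k` the given immersion, finitely many forms
`Gᵢ` of one degree with AFFINE `Y_{Gᵢ} = r⁻¹ D₊(Gᵢ)` cover `Y` (`exists_forms_isAffineOpen_iSup_eq_top`); the sections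
`(r h)^* Gᵢ` give generating-sections data on `X` (★ `GeneratingSections.ofForms`) with the affine charts `h⁻¹(Y_{Gᵢ})`, so
`X` is quasi-projective by ★ `GeneratingSections.isQuasiProjectiveOver_of_isAffineOpen`.
[cite: GortzWedhorn2020, Thm. 13.84 (p. 408) and Prop. 13.76 (p. 405) with Summary 13.71 (1) (p. 404)]
[cite: EGAII, Prop. 5.3.4 (ii) and Cor. 5.3.3] -/
theorem isQuasiProjectiveOver_of_isAffineHom [IsAffineHom h.left] [LocallyOfFiniteType X.hom]
    (hY : IsQuasiProjectiveOver Y) : IsQuasiProjectiveOver X := by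
  classical
  have hqc : QuasiCompact Y.hom := hY.isVarietyPair_ofScheme.quasiCompact
  obtain ⟨P, j, ⟨n, ι, hι⟩, hj⟩ := hY
  letI := MvPolynomial.gradedAlgebra (σ := Fin (n + 1)) (R := k)
  -- the immersion `r = ι ∘ j : Y ↪ ℙⁿ_k`, at the unfolded types
  set ιl : P.left ⟶ Proj (MvPolynomial.homogeneousSubmodule (Fin (n + 1)) k) := ι.left with hιl
  haveI : IsClosedImmersion ιl := hι
  set jl : Y.left ⟶ P.left := j.left with hjl
  haveI : IsOpenImmersion jl := hj
  set r : Y.left ⟶ Proj (MvPolynomial.homogeneousSubmodule (Fin (n + 1)) k) := jl ≫ ιl with hr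
  haveI : IsImmersion r := inferInstance
  haveI : CompactSpace Y.left := (quasiCompact_iff_compactSpace Y.hom).mp hqc
  -- finitely many forms of one degree with affine non-vanishing loci covering `Y`
  obtain ⟨N, d, G, hd, hG, haff, hcov⟩ :=
    exists_forms_isAffineOpen_iSup_eq_top (MvPolynomial.homogeneousSubmodule (Fin (n + 1)) k) r
  -- their pull-backs along the affine `h`: generating sections on `X` with affine charts
  have hcovX : ⨆ i, (h.left ≫ r) ⁻¹ᵁ
      Proj.basicOpen (MvPolynomial.homogeneousSubmodule (Fin (n + 1)) k) (G i) = ⊤ := by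
    simp_rw [Scheme.Hom.comp_preimage]
    rw [← Scheme.Hom.preimage_iSup, hcov, Scheme.Hom.preimage_top]
  let D : GeneratingSections (Fin N) X.left := GeneratingSections.ofForms (h.left ≫ r) G hG hd hcovX
  have hU : ∀ i, IsAffineOpen (D.U i) := fun i ↦ by
    change IsAffineOpen ((h.left ≫ r) ⁻¹ᵁ Proj.basicOpen _ (G i))
    rw [Scheme.Hom.comp_preimage]
    exact (haff i).preimage h.left
  exact D.isQuasiProjectiveOver_of_isAffineOpen hU

/-- **A scheme FINITE over a quasi-projective `k`-scheme is quasi-projective** (EGA II, Cor. 6.1.11 with Prop. 5.3.4 (ii) and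
Cor. 5.3.3; Görtz–Wedhorn I, Prop. 13.76): `h` finite is affine, and `X → Y → Spec k` is locally of finite type.
[cite: EGAII, Cor. 6.1.11 and Prop. 5.3.4 (ii)] [cite: GortzWedhorn2020, Prop. 13.76 (p. 405)] -/
theorem isQuasiProjectiveOver_of_isFinite [IsFinite h.left] (hY : IsQuasiProjectiveOver Y) : IsQuasiProjectiveOver X := by
  haveI : LocallyOfFiniteType Y.hom := hY.isVarietyPair_ofScheme.locallyOfFiniteType
  haveI : LocallyOfFiniteType X.hom := by rw [← Over.w h]; infer_instance
  exact isQuasiProjectiveOver_of_isAffineHom h hY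

end Main

/-! ### Discharge of the named fact -/

/-- **DISCHARGE of the named fact `EGAII_isQuasiProjectiveOver_of_isFinite`** (EGA II, Cor. 6.1.11 «tout morphisme fini est
projectif» with Prop. 5.3.4 (ii) and Cor. 5.3.3): over any field `k`, a `k`-scheme finite over a quasi-projective
`k`-scheme is quasi-projective. [cite: EGAII, Cor. 6.1.11, Prop. 5.3.4 (ii) and Cor. 5.3.3] -/
theorem EGAII_isQuasiProjectiveOver_of_isFinite_holds : EGAII_isQuasiProjectiveOver_of_isFinite.{u} := by
  intro k _ X Y h hh hY
  exact isQuasiProjectiveOver_of_isFinite h hY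

end Literature.AlgebraicGeometry.HodgeTheory

end
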